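import Summits.AtomisticToContinuum.Crystallization.Theorems.ChartedZeroExcessLayeredLatticeLiouvilleZZZYRDR

/-!
# ChartedZeroExcess · LayeredLatticeLiouville ZZZYRDS (lens-2 g98 «EK-SIM» — SIMILARITY COVARIANCE of NODE E's cell certificates; the
regular-cell case of (CC♯) at EVERY position, scale and orientation) — docket 26636

TARGET: NODE E's crux (CC♯) `CellCertificateP` (tree ZZZYRD (239)) and the K-unit «EK-REG» (ZZZYRDR: the certificates at the two REFERENCE
cells of the integer fcc frame).  THIS FILE is the M-class bridge named in ZZZYRDR's docstring and inside «CELLBOX-SOUND» (critic r1765 (E)(1)):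
(1) the matrix `linMat Q` of a linear isometry `Q : E3 ≃ₗᵢ[ℝ] E3` in standard coordinates is orthogonal (`linMat_transpose_mul_self`,
`abs_det_linMat`), and `Q x i = Σ_j linMat Q i j · x j` (`li_apply_coord`);
(2) COVARIANCE under the similarity `P ↦ s·Q·P + v` of the positions together with `Φ ↦ Q·Φ` of the field: the displacement and stretch terms
are invariant (`pairN_isometry`, `pairS_similar`), the edge matrix transforms by `s·linMat Q · —` (`edgeMat_similar`), `σ₂` is a degree-2
conjugation invariant (`sigmaTwo_smul`, `sigmaTwo_conj`), hence the null-Lagrangian terms are of DEGREE ONE in the scale (`simplexNL_similar`,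
`octNL_similar` — the degenerate-volume case included, where both sides vanish);
(3) the FREE certificate functionals `tetCertFree c μ P Φ` / `octCertFree c μ P Φ` (the objects `tetCert` / `octCert` read through `cellPos` /
`cellVal`: `tetCert_eq_free`, `octCert_eq_free`) transform as `cert(c, μ; s·Q·P + v, Q·Φ) = cert(c, μ·s; P, Φ)` (`tetCertFree_similar`,
`octCertFree_similar`), so «non-negative for every field» is a property of the cell SHAPE modulo similarity with `μ` rescaled
(`tetCertFree_forall_nonneg_similar_iff`, `octCertFree_forall_nonneg_similar_iff`) — the normalisation step of the CELLBOX K-file;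
(4) ★ with «EK-REG»: `0 ≤ tetCert 8 (−4/s) a b w φ t` whenever `cellPos a b w t = s·Q·refTet + v` (`s > 0`), and `0 ≤ octCert 8 (−4/s) a b w φ o`
whenever `cellPos a b w o = s·Q·refOct + v` — (CC♯) with `c = 8` on EVERY REGULAR tetrahedral / octahedral cell (edge `ℓ = s√2`, `μ = −4√2/ℓ`),
for every word, field and labelling (`tetCert_nonneg_of_similar`, `octCert_nonneg_of_similar`).
NOT HERE: identifying the cells of an admissible word as similar / box-B-affine images of the reference cells from `IsAdmissibleWord`
(«CELLBOX-SOUND», lens-2 g99) and the strained box itself (interval K-file of record, c_cell = 10).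
-/

open scoped BigOperators InnerProductSpace RealInnerProductSpace Matrix

namespace Summit.AtomisticToContinuum.Crystallization.Theorems.ChartedZeroExcessLayeredLatticeLiouville

open Literature.Geometry.DiscreteGeometry (inner_fin3)

open Summit.AtomisticToContinuum.Crystallization.Theorems.ChartedPlanarOrderRigidityDoor (E3)

/-! ### The matrix of a linear isometry -/

/-- matrix of a map `E3 → E3` in standard coordinates: column `j` = coordinates of the image of `e_j`. -/
noncomputable def linMat (f : E3 → E3) : Matrix (Fin 3) (Fin 3) ℝ := Matrix.of fun i j => f (EuclideanSpace.single j 1) i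

/-- a vector of `E3` in the standard basis. -/
theorem eq_sum_single (x : E3) :
    x = x 0 • EuclideanSpace.single 0 (1 : ℝ) + x 1 • EuclideanSpace.single 1 (1 : ℝ) + x 2 • EuclideanSpace.single 2 (1 : ℝ) := by
  ext i; fin_cases i <;> simp

/-- coordinates of the image: `Q x i = Σ_j linMat Q i j · x j`. -/
theorem li_apply_coord (Q : E3 ≃ₗᵢ[ℝ] E3) (x : E3) (i : Fin 3) : Q x i = ∑ j, linMat Q i j * x j := by
  conv_lhs => rw [eq_sum_single x]
  simp only [map_add, LinearIsometryEquiv.map_smul, PiLp.add_apply, PiLp.smul_apply, smul_eq_mul, Fin.sum_univ_three, linMat,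
    Matrix.of_apply]
  ring

/-- the matrix of a linear isometry is orthogonal: `Aᵀ A = 1`. -/
theorem linMat_transpose_mul_self (Q : E3 ≃ₗᵢ[ℝ] E3) : (linMat Q)ᵀ * linMat Q = 1 := by
  ext j k
  have h1 := LinearIsometryEquiv.inner_map_map Q (EuclideanSpace.single j (1 : ℝ)) (EuclideanSpace.single k (1 : ℝ))
  rw [inner_fin3, EuclideanSpace.inner_single_left] at h1
  simp only [Matrix.mul_apply, Matrix.transpose_apply, linMat, Matrix.of_apply, Fin.sum_univ_three, Matrix.one_apply]
  rw [h1]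
  by_cases hjk : j = k
  · subst hjk; simp
  · simp [hjk]

/-- … and `A Aᵀ = 1`. -/
theorem linMat_mul_transpose_self (Q : E3 ≃ₗᵢ[ℝ] E3) : linMat Q * (linMat Q)ᵀ = 1 :=
  mul_eq_one_comm.mp (linMat_transpose_mul_self Q)

/-- … hence `|det A| = 1`. -/
theorem abs_det_linMat (Q : E3 ≃ₗᵢ[ℝ] E3) : |(linMat Q).det| = 1 := by
  have h := congrArg Matrix.det (linMat_transpose_mul_self Q)
  rw [Matrix.det_mul, Matrix.det_transpose, Matrix.det_one] at h
  have h2 : |(linMat Q).det| ^ 2 = 1 := by rw [sq_abs, sq]; exact h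
  exact (pow_eq_one_iff_of_nonneg (abs_nonneg _) two_ne_zero).mp h2

/-! ### Covariance of the cell functionals under similarities -/

/-- edge matrix of a similar image: `E(s·Q·P + v) = s · A · E(P)`. -/
theorem edgeMat_similar (Q : E3 ≃ₗᵢ[ℝ] E3) (s : ℝ) (v : E3) (P : Fin 4 → E3) :
    edgeMat (fun i => s • Q (P i) + v) = s • (linMat Q * edgeMat P) := by
  ext i j
  simp only [edgeMat, Matrix.of_apply, Matrix.smul_apply, Matrix.mul_apply, smul_eq_mul, add_sub_add_right_eq_sub, ← smul_sub,
    ← map_sub, PiLp.smul_apply, li_apply_coord]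

/-- edge matrix of a rotated field: `E(Q·Ψ) = A · E(Ψ)`. -/
theorem edgeMat_isometry (Q : E3 ≃ₗᵢ[ℝ] E3) (Ψ : Fin 4 → E3) : edgeMat (fun i => Q (Ψ i)) = linMat Q * edgeMat Ψ := by
  simpa using edgeMat_similar Q 1 0 Ψ

/-- `σ₂` is homogeneous of degree two. -/
theorem sigmaTwo_smul (c : ℝ) (G : Matrix (Fin 3) (Fin 3) ℝ) : sigmaTwo (c • G) = c ^ 2 * sigmaTwo G := by
  simp only [sigmaTwo, Matrix.trace_smul, Matrix.smul_mul, Matrix.mul_smul, smul_eq_mul]; ring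

/-- `σ₂` is a conjugation invariant. -/
theorem sigmaTwo_conj (A B G : Matrix (Fin 3) (Fin 3) ℝ) (h : B * A = 1) : sigmaTwo (A * G * B) = sigmaTwo G := by
  have t1 : Matrix.trace (A * G * B) = Matrix.trace G := by
    rw [Matrix.trace_mul_cycle, h, Matrix.one_mul]
  have t2 : Matrix.trace (A * G * B * (A * G * B)) = Matrix.trace (G * G) := by
    have e : A * G * B * (A * G * B) = A * (G * G) * B := by
      calc A * G * B * (A * G * B) = A * G * (B * A) * G * B := by simp only [Matrix.mul_assoc]
        _ = A * (G * G) * B := by rw [h, Matrix.mul_one]; simp only [Matrix.mul_assoc]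
    rw [e, Matrix.trace_mul_cycle, h, Matrix.one_mul]
  simp only [sigmaTwo, t1, t2]

/-- ★ SIMILARITY COVARIANCE of the null-Lagrangian term: degree ONE in the scale. -/
theorem simplexNL_similar (Q : E3 ≃ₗᵢ[ℝ] E3) {s : ℝ} (hs : 0 < s) (v : E3) (P Ψ : Fin 4 → E3) :
    simplexNL (fun i => s • Q (P i) + v) (fun i => Q (Ψ i)) = s * simplexNL P Ψ := by
  have hA := linMat_transpose_mul_self Q
  have hA' := linMat_mul_transpose_self Q
  have hdA := abs_det_linMat Q
  have hs0 : s ≠ 0 := hs.ne'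
  unfold simplexNL simplexVol affGrad
  rw [edgeMat_similar, edgeMat_isometry]
  have hdet3 : (s • (linMat Q * edgeMat P)).det = s ^ 3 * (linMat Q).det * (edgeMat P).det := by
    rw [Matrix.det_smul, Matrix.det_mul, Fintype.card_fin]; ring
  by_cases hE : (edgeMat P).det = 0
  · have h0 : (s • (linMat Q * edgeMat P)).det = 0 := by rw [hdet3, hE, mul_zero]
    rw [h0, hE]; simp
  · have hsE : IsUnit (edgeMat P).det := isUnit_iff_ne_zero.mpr hE
    have hinv : (s • (linMat Q * edgeMat P))⁻¹ = s⁻¹ • ((edgeMat P)⁻¹ * (linMat Q)ᵀ) := by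
      apply Matrix.inv_eq_right_inv
      rw [Matrix.smul_mul, Matrix.mul_smul, smul_smul, mul_inv_cancel₀ hs0, one_smul]
      calc linMat Q * edgeMat P * ((edgeMat P)⁻¹ * (linMat Q)ᵀ) = linMat Q * (edgeMat P * (edgeMat P)⁻¹) * (linMat Q)ᵀ := by
            simp only [Matrix.mul_assoc]
        _ = 1 := by rw [Matrix.mul_nonsing_inv _ hsE, Matrix.mul_one, hA']
    rw [hinv, Matrix.mul_smul, hdet3]
    have hconj : linMat Q * edgeMat Ψ * ((edgeMat P)⁻¹ * (linMat Q)ᵀ) = linMat Q * (edgeMat Ψ * (edgeMat P)⁻¹) * (linMat Q)ᵀ := by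
      simp only [Matrix.mul_assoc]
    rw [hconj, sigmaTwo_smul, sigmaTwo_conj _ _ _ hA, abs_mul, abs_mul, abs_pow, abs_of_pos hs, hdA]
    field_simp

/-- the octahedral null-Lagrangian term is of degree one in the scale as well. -/
theorem octNL_similar (Q : E3 ≃ₗᵢ[ℝ] E3) {s : ℝ} (hs : 0 < s) (v : E3) (P Ψ : Fin 6 → E3) :
    octNL (fun i => s • Q (P i) + v) (fun i => Q (Ψ i)) = s * octNL P Ψ := by
  simp only [octNL, Function.comp_def, Finset.mul_sum]
  refine Finset.sum_congr rfl fun k _ => ?_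
  exact simplexNL_similar Q hs v (fun i => P (octSub k i)) (fun i => Ψ (octSub k i))

/-- the displacement term is invariant. -/
theorem pairN_isometry {k : ℕ} (Q : E3 ≃ₗᵢ[ℝ] E3) (Ψ : Fin k → E3) (p : Fin k × Fin k) :
    pairN (fun i => Q (Ψ i)) p = pairN Ψ p := by
  simp only [pairN, ← map_sub, LinearIsometryEquiv.norm_map]

/-- the stretch term is invariant (`s ≠ 0`). -/
theorem pairS_similar {k : ℕ} (Q : E3 ≃ₗᵢ[ℝ] E3) {s : ℝ} (hs : s ≠ 0) (v : E3) (P Ψ : Fin k → E3) (p : Fin k × Fin k) :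
    pairS (fun i => s • Q (P i) + v) (fun i => Q (Ψ i)) p = pairS P Ψ p := by
  simp only [pairS, add_sub_add_right_eq_sub, ← smul_sub, ← map_sub, real_inner_smul_left, LinearIsometryEquiv.inner_map_map,
    norm_smul, LinearIsometryEquiv.norm_map, Real.norm_eq_abs, mul_pow, sq_abs]
  exact mul_div_mul_left _ _ (pow_ne_zero 2 hs)

/-! ### Free certificate functionals and their covariance -/

/-- the FREE tet certificate functional of a labelled position / field pair (`tetCert` read through `cellPos` / `cellVal`). -/
noncomputable def tetCertFree (c μ : ℝ) (P Φ : Fin 4 → E3) : ℝ :=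
  (c * ∑ p ∈ tetPairs, pairS P Φ p - ∑ p ∈ tetPairs, pairN Φ p) / 6 - μ * simplexNL P Φ

/-- the FREE oct certificate functional. -/
noncomputable def octCertFree (c μ : ℝ) (P Φ : Fin 6 → E3) : ℝ :=
  (c * ∑ p ∈ octPairs, pairS P Φ p - ∑ p ∈ octPairs, pairN Φ p) / 3 - μ * octNL P Φ

/-- the object `tetCert` is the free functional at `(cellPos, cellVal)`. -/
theorem tetCert_eq_free (c μ : ℝ) (a b : E3) (w : ℤ → E3) (φ : Cell 2 → ℤ → E3) (t : Fin 4 → Cell 2 × ℤ) :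
    tetCert c μ a b w φ t = tetCertFree c μ (cellPos a b w t) (cellVal φ t) := by
  unfold tetCert tetS tetN tetNL tetCertFree; rfl

/-- the object `octCert` is the free functional at `(cellPos, cellVal)`. -/
theorem octCert_eq_free (c μ : ℝ) (a b : E3) (w : ℤ → E3) (φ : Cell 2 → ℤ → E3) (o : Fin 6 → Cell 2 × ℤ) :
    octCert c μ a b w φ o = octCertFree c μ (cellPos a b w o) (cellVal φ o) := by
  unfold octCert octS octN octNLw octCertFree; rfl

/-- ★ COVARIANCE: `tetCertFree c μ (s·Q·P + v) (Q·Φ) = tetCertFree c (μ·s) P Φ`. -/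
theorem tetCertFree_similar (Q : E3 ≃ₗᵢ[ℝ] E3) {s : ℝ} (hs : 0 < s) (v : E3) (c μ : ℝ) (P Φ : Fin 4 → E3) :
    tetCertFree c μ (fun i => s • Q (P i) + v) (fun i => Q (Φ i)) = tetCertFree c (μ * s) P Φ := by
  simp only [tetCertFree, pairS_similar Q hs.ne', pairN_isometry Q, simplexNL_similar Q hs, mul_assoc]

/-- ★ COVARIANCE: `octCertFree c μ (s·Q·P + v) (Q·Φ) = octCertFree c (μ·s) P Φ`. -/
theorem octCertFree_similar (Q : E3 ≃ₗᵢ[ℝ] E3) {s : ℝ} (hs : 0 < s) (v : E3) (c μ : ℝ) (P Φ : Fin 6 → E3) :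
    octCertFree c μ (fun i => s • Q (P i) + v) (fun i => Q (Φ i)) = octCertFree c (μ * s) P Φ := by
  simp only [octCertFree, pairS_similar Q hs.ne', pairN_isometry Q, octNL_similar Q hs, mul_assoc]

/-- «non-negative for every field» is a property of the cell shape modulo similarity, with `μ` rescaled by the scale. -/
theorem tetCertFree_forall_nonneg_similar_iff (Q : E3 ≃ₗᵢ[ℝ] E3) {s : ℝ} (hs : 0 < s) (v : E3) (c μ : ℝ) (P : Fin 4 → E3) :
    (∀ Φ, 0 ≤ tetCertFree c μ (fun i => s • Q (P i) + v) Φ) ↔ ∀ Φ, 0 ≤ tetCertFree c (μ * s) P Φ := by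
  constructor
  · intro h Φ; rw [← tetCertFree_similar Q hs v c μ P Φ]; exact h _
  · intro h Φ
    have e : Φ = fun i => Q (Q.symm (Φ i)) := funext fun i => (Q.apply_symm_apply _).symm
    rw [e, tetCertFree_similar Q hs]; exact h _

/-- the octahedral analogue. -/
theorem octCertFree_forall_nonneg_similar_iff (Q : E3 ≃ₗᵢ[ℝ] E3) {s : ℝ} (hs : 0 < s) (v : E3) (c μ : ℝ) (P : Fin 6 → E3) :
    (∀ Φ, 0 ≤ octCertFree c μ (fun i => s • Q (P i) + v) Φ) ↔ ∀ Φ, 0 ≤ octCertFree c (μ * s) P Φ := by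
  constructor
  · intro h Φ; rw [← octCertFree_similar Q hs v c μ P Φ]; exact h _
  · intro h Φ
    have e : Φ = fun i => Q (Q.symm (Φ i)) := funext fun i => (Q.apply_symm_apply _).symm
    rw [e, octCertFree_similar Q hs]; exact h _

/-! ### (CC♯) with `c = 8` on every regular cell -/

/-- the reference tet certificate of «EK-REG» in free form: every `c ≥ 8` at `μ = −4`. -/
theorem tetCertFree_ref_nonneg (Φ : Fin 4 → E3) : 0 ≤ tetCertFree 8 (-4) refTet Φ := tetCertRef_nonneg Φ

/-- the reference oct certificate of «EK-REG» in free form. -/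
theorem octCertFree_ref_nonneg (Φ : Fin 6 → E3) : 0 ≤ octCertFree 8 (-4) refOct Φ := octCertRef_nonneg Φ

/-- ★★ (CC♯ 8) at ANY REGULAR TETRAHEDRAL CELL: if the labelled positions are a similar image `s·Q·refTet + v` (`s > 0`, `Q` a linear
isometry; edge `ℓ = s√2`) then `0 ≤ tetCert 8 (−4/s) a b w φ t` for every field — the multiplier of record `μ = −4√2/ℓ`. -/
theorem tetCert_nonneg_of_similar (Q : E3 ≃ₗᵢ[ℝ] E3) {s : ℝ} (hs : 0 < s) (v a b : E3) (w : ℤ → E3) (φ : Cell 2 → ℤ → E3)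
    (t : Fin 4 → Cell 2 × ℤ) (h : cellPos a b w t = fun i => s • Q (refTet i) + v) : 0 ≤ tetCert 8 (-4 / s) a b w φ t := by
  rw [tetCert_eq_free, h]
  refine (tetCertFree_forall_nonneg_similar_iff Q hs v 8 (-4 / s) refTet).mpr (fun Φ => ?_) _
  rw [div_mul_cancel₀ _ hs.ne']
  exact tetCertFree_ref_nonneg Φ

/-- ★★ (CC♯ 8) at ANY REGULAR OCTAHEDRAL CELL (antipode-respecting labelling): positions `s·Q·refOct + v` ⇒ `0 ≤ octCert 8 (−4/s) a b w φ o`. -/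
theorem octCert_nonneg_of_similar (Q : E3 ≃ₗᵢ[ℝ] E3) {s : ℝ} (hs : 0 < s) (v a b : E3) (w : ℤ → E3) (φ : Cell 2 → ℤ → E3)
    (o : Fin 6 → Cell 2 × ℤ) (h : cellPos a b w o = fun i => s • Q (refOct i) + v) : 0 ≤ octCert 8 (-4 / s) a b w φ o := by
  rw [octCert_eq_free, h]
  refine (octCertFree_forall_nonneg_similar_iff Q hs v 8 (-4 / s) refOct).mpr (fun Φ => ?_) _
  rw [div_mul_cancel₀ _ hs.ne']
  exact octCertFree_ref_nonneg Φ

end Summit.AtomisticToContinuum.Crystallization.Theorems.ChartedZeroExcessLayeredLatticeLiouville
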